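import Summits.BirchSwinnertonDyer.Rank1Residual.GaloisImage.WildNineTorsionAbscissaValuation
import HarnessLib

/-!
# The VÉLU-abscissa valuation on the wild locus `1 ≤ v₃(j − 1728) = m ≤ 4`:
# `v(X(x_Q) − X(e))¹⁶² = v(Δ)²⁷ · v(3)^{15m}` for the `3`-isogeny abscissa map `X` of `⟨3Q⟩`
# (cell `b2b-bsdres`, team n1011, seat p02 gen 5 — row T-b11-F4, file F4c-II 'the E′ = E/⟨3Q⟩
# mechanism'; sequel of F3b `WildNineTorsionAbscissaValuation`, same transport, one new identity)

HONEST FRAMING (cell `b2b-bsdres`, run/shared/lean/b2b/bsd-rank1-residual/, verbatim in every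
file): the goal of the cell is to DELETE the COMBINATION-SHAPED residual classes of the
Birch–Swinnerton-Dyer formula for ALL analytic-rank `≤ 1` elliptic curves over `ℚ` — "full BSD
formula for every rank `≤ 1` curve in class `C`" assembled STRICTLY from published theorems — so
that the rank-`≤ 1` remainder becomes exactly the CONSTRUCTION-SHAPED classes, which are TYPED
(missing-input `Prop`s), NOT attempted. This is not "finishing BSD". Team n1011 (N10 / N11):
research route; no claim beyond the stated classes; labels UNCHANGED; nothing is booked. Theorems
only (no definition, no named fact).

## What this file proves

For a point `P = (ξ, η)` of `E` write `t_P = 6ξ² + b₂ξ + b₄`, `u_P = 4ξ³ + b₂ξ² + 2b₄ξ + b₆`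
(`= Ψ₂²(ξ)`) and `X(x) = x + t_P/(x − ξ) + u_P/(x − ξ)²` — Vélu's abscissa map for the
`3`-isogeny `E → E/⟨P⟩` when `3P = O` (no isogeny theory is used: `X` is just this rational
function).

* `addX_add_addX_negY_eq` (§0, any Weierstrass curve over a field) — the addition formula
  `x(R + P) + x(R − P) = 2x_P + t_P/(x_R − x_P) + u_P/(x_R − x_P)²`; so
  `X(x(R)) = x(R) + x(R + P) + x(R − P) − 2x(P)`.
* `velu_sub_mul_eq_of_shape` (§1) — in the normal shape `y² = x³ + A x² + x` and with the
  `2`-torsion abscissa `e = 0`: **`(X(x) − X(0)) · (x − ξ)² · ξ = x · (ξx² − 2x + 3ξ³ + 4Aξ² + 6ξ)`**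
  (pure algebra; the constant term in `x` cancels).
* `valuation_velu_sub_pow_162_of_shape` (§1) — if `v(A)⁶ = v(3)^m`, `v(ξ)¹⁸ v(3)^m = 1`
  (a NON-CANONICAL `3`-torsion abscissa) and `v(x)¹⁶² v(3)^m = 1` (a `9`-torsion abscissa above it),
  `1 ≤ m ≤ 4`, then **`v(X(x) − X(0))¹⁶² = v(3)^{15m}`** (`ξx²` dominates: `val = 5m/54`; at
  `m = 3`: `5/18`).
* **`exists_nineTorsion_velu_sub_valuation`** (§2, any model `W/ℚ`) — for `1 ≤ v₃(j − 1728) = m ≤ 4`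
  there are `Q = (x₀, y₀)` with `9Q = O`, `3Q = P = (ξ, η)`, and a `2`-torsion point `T = (e, y_e)`
  with `x₀ ≠ ξ`, `e ≠ ξ` and **`v(X(x₀) − X(e))¹⁶² = v(Δ)²⁷ · v(3)^{15m}`**, i.e.
  `val(X(x₀) − X(e)) = v₃(Δ)/6 + 5m/54` (transport `x₀ = u²x'' + r`, `ξ = u²ξ'' + r`, `e = r`,
  `t_P = u⁴t''`, `u_P = u⁶u''`, `X_W − X_W = u²(X'' − X'')`, `v(u)¹² = v(Δ)`).

At `m = 3` this is the E′ = E/⟨3Q⟩ MECHANISM of the seat's F4 note: by §0, `X(x₀)` is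
`x(Q) + x(4Q) + x(2Q) − 2x(3Q) = s₁(C) − 2x(3Q)`, an invariant of the cyclic `9`-subgroup `C = ⟨Q⟩`,
and `val = v₃(Δ)/6 + 5/18` has `3`-adic denominator `9` — EVIDENCE kit j134263: 749/749 census cells
with `v₃(j − 1728) = 3` (81/81 conjugates each).  NOT given here: an element of `ℚ(C)` itself
(`X(e) ∉ ℚ(C)`); approximating `X(e)` inside `ℚ(C)` (numerically `c₆/3^{n₄} − 2x̂(3Q)` at
`v₃(j) = 4`, M3-LOCAL-NOTE §8.7) is the remaining target F4c-III.  Nothing booked; no label change.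
References: [SilvermanAEC2009] III.1 Table 3.1, III.2.3, Ex. 3.7; [Velu1971] C. R. Acad. Sci.
Paris 273 (1971) 238–241.
-/

noncomputable section

-- as in `WildThreeAdicTower`: numerals `x ^ 162` on the value group need a deeper recursion limit
set_option maxRecDepth 10000

open scoped Classical

open Polynomial WeierstrassCurve

namespace Summit.BirchSwinnertonDyer.Rank1Residual.GaloisImage

open Literature.NumberTheory.EllipticCurves Literature.NumberTheory.GaloisRepresentations
  Rat.HeightOneSpectrum

/-! ### §0 The addition formula behind `X`: `x(R + P) + x(R − P) = 2ξ + t_P/(x_R − ξ) + u_P/(x_R − ξ)²` -/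

section AddX

variable {F : Type*} [Field F] (W : WeierstrassCurve F)

/-- **`x(R + P) + x(R − P) = 2x_P + t_P/(x_R − x_P) + u_P/(x_R − x_P)²`** for affine points
`R = (x₁, y₁)`, `P = (x₂, y₂)` with `x₁ ≠ x₂` on any Weierstrass curve over a field
(`t_P = 6x₂² + b₂x₂ + b₄`, `u_P = 4x₂³ + b₂x₂² + 2b₄x₂ + b₆ = Ψ₂²(x₂)`), written with Mathlib's
`addX`/`slope`/`negY`: the abscissae of `R ± P` are `addX x₁ x₂ (slope x₁ x₂ y₁ (±y₂))`.  So Vélu's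
abscissa map `X(x_R) = x_R + t_P/(x_R − x_P) + u_P/(x_R − x_P)²` equals
`x(R) + x(R + P) + x(R − P) − 2x(P)`; for `Q` of order `9` and `P = 3Q` this is
`x(Q) + x(4Q) + x(2Q) − 2x(3Q)`, an invariant of the cyclic subgroup `⟨Q⟩`.
[cite: SilvermanAEC2009, III.2.3 (group law algorithm)] -/
theorem addX_add_addX_negY_eq {x₁ y₁ x₂ y₂ : F} (h₁ : W.toAffine.Equation x₁ y₁) (h₂ : W.toAffine.Equation x₂ y₂)
    (hx : x₁ ≠ x₂) :
    W.toAffine.addX x₁ x₂ (W.toAffine.slope x₁ x₂ y₁ y₂) +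
        W.toAffine.addX x₁ x₂ (W.toAffine.slope x₁ x₂ y₁ (W.toAffine.negY x₂ y₂)) =
      2 * x₂ + (6 * x₂ ^ 2 + W.b₂ * x₂ + W.b₄) / (x₁ - x₂) +
        (4 * x₂ ^ 3 + W.b₂ * x₂ ^ 2 + 2 * W.b₄ * x₂ + W.b₆) / (x₁ - x₂) ^ 2 := by
  have hx' : x₁ - x₂ ≠ 0 := sub_ne_zero.mpr hx
  rw [Affine.slope_of_X_ne hx, Affine.slope_of_X_ne hx]
  rw [Affine.equation_iff] at h₁ h₂
  simp only [Affine.addX, Affine.negY, WeierstrassCurve.b₂, WeierstrassCurve.b₄, WeierstrassCurve.b₆]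
  field_simp
  linear_combination 2 * h₁ + 2 * h₂

end AddX

/-! ### §1 The identity and the valuation in normal shape -/

section Shape

variable {W : WeierstrassCurve (AlgebraicClosure ℚ)}

/-- **`(X(x) − X(0))·(x − ξ)²·ξ = x·(ξx² − 2x + 3ξ³ + 4Aξ² + 6ξ)`** in the normal shape
`y² = x³ + Ax² + x` (`t_ξ = 6ξ² + 4Aξ + 2`, `u_ξ = 4ξ³ + 4Aξ² + 4ξ`): the term free of `x` cancels.
[folklore] -/
theorem velu_sub_mul_eq_of_shape (A : (AlgebraicClosure ℚ)) {x ξ : (AlgebraicClosure ℚ)} (hξ : ξ ≠ 0) (hxξ : x - ξ ≠ 0) :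
    ((x + (6 * ξ ^ 2 + 4 * A * ξ + 2) / (x - ξ) + (4 * ξ ^ 3 + 4 * A * ξ ^ 2 + 4 * ξ) / (x - ξ) ^ 2) -
      (0 + (6 * ξ ^ 2 + 4 * A * ξ + 2) / (0 - ξ) + (4 * ξ ^ 3 + 4 * A * ξ ^ 2 + 4 * ξ) / (0 - ξ) ^ 2)) *
      ((x - ξ) ^ 2 * ξ) =
    x * (ξ * x ^ 2 - 2 * x + 3 * ξ ^ 3 + 4 * A * ξ ^ 2 + 6 * ξ) := by
  have h0ξ : (0 : (AlgebraicClosure ℚ)) - ξ ≠ 0 := by rwa [zero_sub, neg_ne_zero]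
  field_simp
  ring

/-- **`v(X(x) − X(0))¹⁶² = v(3)^{15m}`** in the normal shape with `v(A)⁶ = v(3)^m`,
`v(ξ)¹⁸ v(3)^m = 1` and `v(x)¹⁶² v(3)^m = 1`, `1 ≤ m ≤ 4`: in §1's identity `ξx²` dominates the
bracket (margins `11m > m`, `162 + 11m > 27m`, `38m > 18m`, `162 + 11m > 9m` after raising to the
`162`-nd power) and `v(x − ξ) = v(ξ)`, so `v(X(x) − X(0)) = v(x)³/v(ξ)²`. [folklore] -/
theorem valuation_velu_sub_pow_162_of_shape (A : (AlgebraicClosure ℚ)) {m : ℕ} (hm1 : 1 ≤ m) (hm4 : m ≤ 4)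
    (hα : (placeOver 3).valuation A ^ 6 = (placeOver 3).valuation (3 : (AlgebraicClosure ℚ)) ^ m)
    {x ξ : (AlgebraicClosure ℚ)} (hξ : (placeOver 3).valuation ξ ^ 18 * (placeOver 3).valuation (3 : (AlgebraicClosure ℚ)) ^ m = 1)
    (hx : (placeOver 3).valuation x ^ 162 * (placeOver 3).valuation (3 : (AlgebraicClosure ℚ)) ^ m = 1) :
    (placeOver 3).valuation
        ((x + (6 * ξ ^ 2 + 4 * A * ξ + 2) / (x - ξ) + (4 * ξ ^ 3 + 4 * A * ξ ^ 2 + 4 * ξ) / (x - ξ) ^ 2) -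
          (0 + (6 * ξ ^ 2 + 4 * A * ξ + 2) / (0 - ξ) + (4 * ξ ^ 3 + 4 * A * ξ ^ 2 + 4 * ξ) / (0 - ξ) ^ 2))
        ^ 162 =
      (placeOver 3).valuation (3 : (AlgebraicClosure ℚ)) ^ (15 * m) := by
  set v := (placeOver 3).valuation with hv
  set t := v (3 : (AlgebraicClosure ℚ)) with ht
  have ht1 : t < 1 := valuation_three_lt_one
  have ht0 : t ≠ 0 := valuation_three_ne_zero
  have hv2 : v (2 : (AlgebraicClosure ℚ)) = 1 := by simpa using valuation_intCast_eq_one_of_not_dvd (n := 2) (by decide)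
  have hv4 : v (4 : (AlgebraicClosure ℚ)) = 1 := by simpa using valuation_intCast_eq_one_of_not_dvd (n := 4) (by decide)
  -- records `v(a)^162 * t^p = t^q` for the atoms, their products/powers, and strict comparison
  have hx' : v x ^ 162 * t ^ m = t ^ 0 := by rw [pow_zero]; exact hx
  have hξ' : v ξ ^ 162 * t ^ (9 * m) = t ^ 0 := by
    rw [pow_zero, show (162 : ℕ) = 18 * 9 from rfl, pow_mul, show (9 * m : ℕ) = m * 9 from Nat.mul_comm _ _,
      pow_mul, ← mul_pow, hξ, one_pow]
  have hA' : v A ^ 162 * t ^ 0 = t ^ (27 * m) := by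
    rw [pow_zero, mul_one, show (162 : ℕ) = 6 * 27 from rfl, pow_mul, hα, ← pow_mul, Nat.mul_comm m 27]
  have h3' : v (3 : (AlgebraicClosure ℚ)) ^ 162 * t ^ 0 = t ^ 162 := by rw [pow_zero, mul_one]
  have h2' : v (2 : (AlgebraicClosure ℚ)) ^ 162 * t ^ 0 = t ^ 0 := by rw [hv2, one_pow, pow_zero, mul_one]
  have h4' : v (4 : (AlgebraicClosure ℚ)) ^ 162 * t ^ 0 = t ^ 0 := by rw [hv4, one_pow, pow_zero, mul_one]
  have h6' : v (6 : (AlgebraicClosure ℚ)) ^ 162 * t ^ 0 = t ^ 162 := by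
    rw [pow_zero, mul_one, show (6 : (AlgebraicClosure ℚ)) = 2 * 3 by norm_num, map_mul, mul_pow, hv2, one_pow, one_mul]
  have hmul : ∀ {X Y : (AlgebraicClosure ℚ)} {p q p' q' : ℕ}, v X ^ 162 * t ^ p = t ^ q → v Y ^ 162 * t ^ p' = t ^ q' →
      v (X * Y) ^ 162 * t ^ (p + p') = t ^ (q + q') := by
    intro X Y p q p' q' hX hY
    rw [map_mul, mul_pow, pow_add, pow_add, ← hX, ← hY]
    simp only [mul_assoc, mul_left_comm]
  have hpw : ∀ {X : (AlgebraicClosure ℚ)} {p q : ℕ} (k : ℕ), v X ^ 162 * t ^ p = t ^ q →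
      v (X ^ k) ^ 162 * t ^ (p * k) = t ^ (q * k) := by
    intro X p q k hX
    rw [map_pow, ← pow_mul, Nat.mul_comm k 162, pow_mul, pow_mul, pow_mul, ← mul_pow, hX]
  have hlt : ∀ {X Y : (AlgebraicClosure ℚ)} {p q p' q' : ℕ}, v X ^ 162 * t ^ p = t ^ q → v Y ^ 162 * t ^ p' = t ^ q' →
      q' + p < q + p' → v X < v Y := by
    intro X Y p q p' q' hX hY hlt
    refine lt_of_pow_lt_pow_left₀ 162 zero_le ?_
    have key : v X ^ 162 * t ^ (p + p') < v Y ^ 162 * t ^ (p + p') := by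
      calc v X ^ 162 * t ^ (p + p') = t ^ (q + p') := by rw [pow_add, ← mul_assoc, hX, ← pow_add]
        _ < t ^ (q' + p) := (pow_lt_pow_iff_of_lt_one' ht0 ht1).mpr hlt
        _ = v Y ^ 162 * t ^ (p + p') := by
          rw [Nat.add_comm p p', pow_add, pow_add, ← mul_assoc, hY]
    exact lt_of_mul_lt_mul_right' key
  have rξx2 : v (ξ * x ^ 2) ^ 162 * t ^ (9 * m + m * 2) = t ^ (0 + 0 * 2) := hmul hξ' (hpw 2 hx')
  have r2x : v (2 * x) ^ 162 * t ^ (0 + m) = t ^ (0 + 0) := hmul h2' hx'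
  have r3ξ3 : v (3 * ξ ^ 3) ^ 162 * t ^ (0 + 9 * m * 3) = t ^ (162 + 0 * 3) := hmul h3' (hpw 3 hξ')
  have r4Aξ2 : v (4 * A * ξ ^ 2) ^ 162 * t ^ (0 + 0 + 9 * m * 2) = t ^ (0 + 27 * m + 0 * 2) :=
    hmul (hmul h4' hA') (hpw 2 hξ')
  have r6ξ : v (6 * ξ) ^ 162 * t ^ (0 + 9 * m) = t ^ (162 + 0) := hmul h6' hξ'
  -- `v(q) = v(ξx²)`
  have hq : v (ξ * x ^ 2 - 2 * x + 3 * ξ ^ 3 + 4 * A * ξ ^ 2 + 6 * ξ) = v (ξ * x ^ 2) := by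
    have l1 : v (2 * x) < v (ξ * x ^ 2) := hlt r2x rξx2 (by omega)
    have l2 : v (3 * ξ ^ 3) < v (ξ * x ^ 2) := hlt r3ξ3 rξx2 (by omega)
    have l3 : v (4 * A * ξ ^ 2) < v (ξ * x ^ 2) := hlt r4Aξ2 rξx2 (by omega)
    have l4 : v (6 * ξ) < v (ξ * x ^ 2) := hlt r6ξ rξx2 (by omega)
    have s1 : v (ξ * x ^ 2 - 2 * x) = v (ξ * x ^ 2) := valuation_sub_eq_of_lt l1
    have s2 : v (ξ * x ^ 2 - 2 * x + 3 * ξ ^ 3) = v (ξ * x ^ 2) := by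
      rw [← s1] at l2 ⊢; exact Valuation.map_add_eq_of_lt_left _ l2
    have s3 : v (ξ * x ^ 2 - 2 * x + 3 * ξ ^ 3 + 4 * A * ξ ^ 2) = v (ξ * x ^ 2) := by
      rw [← s2] at l3 ⊢; exact Valuation.map_add_eq_of_lt_left _ l3
    rw [← s3] at l4 ⊢; exact Valuation.map_add_eq_of_lt_left _ l4
  -- `v(x − ξ) = v(ξ)`, `ξ ≠ 0`, `x − ξ ≠ 0`
  have hxltξ : v x < v ξ := hlt hx' hξ' (by omega)
  have hxξ : v (x - ξ) = v ξ := valuation_sub_eq_of_lt' hxltξ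
  have hvξ0 : v ξ ≠ 0 := by
    intro h0; rw [h0, zero_pow (by norm_num), zero_mul] at hξ; exact zero_ne_one hξ
  have hξ0 : ξ ≠ 0 := (Valuation.ne_zero_iff _).mp hvξ0
  have hxξ0 : x - ξ ≠ 0 := by
    intro h0; rw [h0, map_zero] at hxξ; exact hvξ0 hxξ.symm
  have hid := congrArg v (velu_sub_mul_eq_of_shape A hξ0 hxξ0)
  rw [map_mul, map_mul, map_mul, map_pow, hxξ, hq] at hid
  have h486 : (v ξ ^ 2 * v ξ) ^ 162 * t ^ (27 * m) = 1 := by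
    rw [← pow_succ, ← pow_mul, show (3 * 162 : ℕ) = 18 * 27 from rfl, pow_mul,
      show (27 * m : ℕ) = m * 27 from Nat.mul_comm _ _, pow_mul, ← mul_pow, hξ, one_pow]
  have rξx2' : v (ξ * x ^ 2) ^ 162 * t ^ (9 * m + m * 2) = 1 := by
    rw [rξx2, zero_mul, add_zero, pow_zero]
  have h := congrArg (fun w ↦ w ^ 162 * t ^ (27 * m)) hid
  rw [mul_pow, mul_assoc, h486, mul_one] at h
  rw [h, mul_pow]
  have e : t ^ (27 * m) = t ^ m * t ^ (9 * m + m * 2) * t ^ (15 * m) := by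
    rw [← pow_add, ← pow_add]; congr 1; ring
  rw [e]
  calc v x ^ 162 * v (ξ * x ^ 2) ^ 162 * (t ^ m * t ^ (9 * m + m * 2) * t ^ (15 * m))
      = (v x ^ 162 * t ^ m) * (v (ξ * x ^ 2) ^ 162 * t ^ (9 * m + m * 2)) * t ^ (15 * m) := by
        simp only [mul_assoc, mul_comm, mul_left_comm]
    _ = t ^ (15 * m) := by rw [hx, rξx2', one_mul, one_mul]

end Shape

/-! ### §2 Transport to an arbitrary model over `ℚ` -/

section Main

variable (W : WeierstrassCurve ℚ) [W.IsElliptic]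

/-- **The Vélu-abscissa valuation witness.**  For `E = W/ℚ` (any model) with
`1 ≤ v₃(j − 1728) = m ≤ 4` there are a geometric point `Q = (x₀, y₀)` with `9Q = O` and
`3Q = P = (ξ, η)` (so `P` has order `3`; it is NON-canonical at `3`) and a `2`-torsion point
`T = (e, y_e)` with `x₀ ≠ ξ`, `e ≠ ξ`, such that for `t_P = 6ξ² + b₂ξ + b₄`,
`u_P = 4ξ³ + b₂ξ² + 2b₄ξ + b₆` and `X(s) = s + t_P/(s − ξ) + u_P/(s − ξ)²`:
**`v(X(x₀) − X(e))¹⁶² = v(Δ)²⁷ · v(3)^{15m}`** (`Δ, b_i` read in `ℚ̄`), i.e.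
`val(X(x₀) − X(e)) = v₃(Δ)/6 + 5m/54` (normal shape, §1, transport `x₀ = u²x'' + r`,
`ξ = u²ξ'' + r`, `e = r`, `t_P = u⁴t''`, `u_P = u⁶u''`, `v(u)¹² = v(Δ)`).  At `m = 3` the valuation
`v₃(Δ)/6 + 5/18` has `3`-adic denominator `9`. [cite: SilvermanAEC2009, III.1 Table 3.1] -/
theorem exists_nineTorsion_velu_sub_valuation {m : ℕ} (hm1 : 1 ≤ m) (hm4 : m ≤ 4)
    (hj : padicValRat 3 (W.j - 1728) = m) :
    ∃ (Q : W.geomPoints) (x y ξ η e ye : (AlgebraicClosure ℚ))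
      (hQ : (W.map (algebraMap ℚ (AlgebraicClosure ℚ))).toAffine.Nonsingular x y)
      (hP : (W.map (algebraMap ℚ (AlgebraicClosure ℚ))).toAffine.Nonsingular ξ η)
      (he : (W.map (algebraMap ℚ (AlgebraicClosure ℚ))).toAffine.Nonsingular e ye),
      Q = .some x y hQ ∧ (9 : ℤ) • Q = 0 ∧
      (3 : ℤ) • Q = (Affine.Point.some ξ η hP : (W.map (algebraMap ℚ (AlgebraicClosure ℚ))).toAffine.Point) ∧
      (2 : ℤ) • (Affine.Point.some e ye he : (W.map (algebraMap ℚ (AlgebraicClosure ℚ))).toAffine.Point) = 0 ∧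
      x - ξ ≠ 0 ∧ e - ξ ≠ 0 ∧
      (placeOver 3).valuation
          ((x + (6 * ξ ^ 2 + algebraMap ℚ (AlgebraicClosure ℚ) W.b₂ * ξ + algebraMap ℚ (AlgebraicClosure ℚ) W.b₄) / (x - ξ) +
              (4 * ξ ^ 3 + algebraMap ℚ (AlgebraicClosure ℚ) W.b₂ * ξ ^ 2 + 2 * algebraMap ℚ (AlgebraicClosure ℚ) W.b₄ * ξ +
                algebraMap ℚ (AlgebraicClosure ℚ) W.b₆) / (x - ξ) ^ 2) -
            (e + (6 * ξ ^ 2 + algebraMap ℚ (AlgebraicClosure ℚ) W.b₂ * ξ + algebraMap ℚ (AlgebraicClosure ℚ) W.b₄) / (e - ξ) +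
              (4 * ξ ^ 3 + algebraMap ℚ (AlgebraicClosure ℚ) W.b₂ * ξ ^ 2 + 2 * algebraMap ℚ (AlgebraicClosure ℚ) W.b₄ * ξ +
                algebraMap ℚ (AlgebraicClosure ℚ) W.b₆) / (e - ξ) ^ 2)) ^ 162 =
        (placeOver 3).valuation (algebraMap ℚ (AlgebraicClosure ℚ) W.Δ) ^ 27 *
          (placeOver 3).valuation (3 : (AlgebraicClosure ℚ)) ^ (15 * m) := by
  set v := (placeOver 3).valuation with hv
  set t := v (3 : (AlgebraicClosure ℚ)) with ht
  have ht0 : t ≠ 0 := valuation_three_ne_zero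
  have ht1 : t < 1 := valuation_three_lt_one
  -- normal shape
  obtain ⟨C, h1, h3, h4, h6, hs, htC⟩ := exists_variableChange_normalShape (W.map (algebraMap ℚ (AlgebraicClosure ℚ)))
  set E'' := C • W.map (algebraMap ℚ (AlgebraicClosure ℚ)) with hE''
  have hq0 : W.j - 1728 ≠ 0 := by
    intro h0; rw [h0, padicValRat.zero] at hj; exact_mod_cast (show (m : ℤ) ≠ 0 by omega) hj.symm
  have hjK : v (E''.j - 1728) = t ^ m := by
    have : E''.j - 1728 = algebraMap ℚ (AlgebraicClosure ℚ) (W.j - 1728) := by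
      rw [show E''.j = (W.map (algebraMap ℚ (AlgebraicClosure ℚ))).j from variableChange_j _ _, map_j, map_sub, map_ofNat]
    rw [this]
    exact valuation_ratCast_eq_pow_of_padicValRat hq0 hj
  obtain ⟨hα1, -, hΔ1, hα⟩ :=
    valuation_a₂_of_shape_of_j (W := E'') h1 h3 h4 h6 hm1 (hm4.trans (by norm_num)) hjK
  -- a non-canonical `3`-torsion point `(ξ'', η'')` of the shape
  obtain ⟨ξ'', hξroot, hξ''⟩ := exists_isRoot_Ψ₃_wild (W := E'') h1 h3 h4 h6 hm1 hm4 hα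
  obtain ⟨η'', hη''⟩ := IsAlgClosed.exists_pow_nat_eq (ξ'' ^ 3 + E''.a₂ * ξ'' ^ 2 + ξ'') (by norm_num : 0 < 2)
  have hPeq : E''.toAffine.Equation ξ'' η'' := by
    rw [Affine.equation_iff, h1, h3, h4, h6, hη'']; ring
  have hPns : E''.toAffine.Nonsingular ξ'' η'' := (Affine.equation_iff_nonsingular ..).mp hPeq
  have hP3 : (3 : ℤ) • (Affine.Point.some ξ'' η'' hPns : E''.toAffine.Point) = 0 := by
    refine (zsmul_some_eq_zero_iff_eval_ΨSq E'' hPns 3).mpr ?_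
    rw [ΨSq_three, eval_pow, hξroot.eq_zero, zero_pow two_ne_zero]
  -- divide by `3` on `W ⊗ ℚ̄`
  set φ := VariableChange.pointEquiv (W.map (algebraMap ℚ (AlgebraicClosure ℚ))) C with hφ
  set P₀ : (W.map (algebraMap ℚ (AlgebraicClosure ℚ))).toAffine.Point := φ.symm (Affine.Point.some ξ'' η'' hPns) with hP₀
  have hP₀3 : (3 : ℤ) • P₀ = 0 := by rw [hP₀, ← map_zsmul, hP3, map_zero]
  obtain ⟨Q₀, hQ₀3⟩ : ∃ Q₀ : (W.map (algebraMap ℚ (AlgebraicClosure ℚ))).toAffine.Point, (3 : ℤ) • Q₀ = P₀ :=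
    W.zsmul_geomPoints_surjective_holds (n := 3) (by norm_num) P₀
  have hQ₀9 : (9 : ℤ) • Q₀ = 0 := by
    rw [show (9 : ℤ) = 3 * 3 by norm_num, mul_smul, hQ₀3, hP₀3]
  have hQ''3 : (3 : ℤ) • φ Q₀ = Affine.Point.some ξ'' η'' hPns := by
    rw [← map_zsmul, hQ₀3, hP₀, AddEquiv.apply_symm_apply]
  have hQ''0 : φ Q₀ ≠ 0 := by
    intro h0; rw [h0, smul_zero] at hQ''3; exact Affine.Point.some_ne_zero _ hQ''3.symm
  rcases hQ'' : φ Q₀ with _ | ⟨x'', y'', h''⟩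
  · exact absurd hQ'' hQ''0
  rw [hQ''] at hQ''3
  have hrel : ξ'' * (E''.Ψ₃.eval x'') ^ 2 = (E''.Φ 3).eval x'' := by
    have := mul_eval_ΨSq_of_zsmul_eq E'' h'' 3 hPns hQ''3
    rwa [ΨSq_three, eval_pow] at this
  have hx'' := valuation_pow_162_eq_of_mul_rel_wild (W := E'') h1 h3 h4 h6 hm1 hm4 hα hrel hξ''
  have hQ₀eq : Q₀ = φ.symm (Affine.Point.some x'' y'' h'') := by
    rw [← hQ'', AddEquiv.symm_apply_apply]
  rw [hφ, VariableChange.pointEquiv_symm_apply, VariableChange.pointInv_some] at hQ₀eq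
  -- the `3`-torsion point `P₀` and the `2`-torsion point `T₀ = C⁻¹ • (0, 0)` on `W`
  have hP₀eq : P₀ = φ.symm (Affine.Point.some ξ'' η'' hPns) := rfl
  rw [hφ, VariableChange.pointEquiv_symm_apply, VariableChange.pointInv_some] at hP₀eq
  have h0eq : E''.toAffine.Equation 0 0 := by
    rw [Affine.equation_iff, h1, h3, h4, h6]; ring
  have h0ns : E''.toAffine.Nonsingular 0 0 := (Affine.equation_iff_nonsingular ..).mp h0eq
  have h02 : (2 : ℤ) • (Affine.Point.some 0 0 h0ns : E''.toAffine.Point) = 0 := by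
    refine (zsmul_some_eq_zero_iff_eval_ΨSq E'' h0ns 2).mpr ?_
    rw [ΨSq_two]
    simp only [WeierstrassCurve.Ψ₂Sq, WeierstrassCurve.b₂, WeierstrassCurve.b₄, WeierstrassCurve.b₆,
      eval_add, eval_mul, eval_C, eval_pow, eval_X, h1, h3, h6]
    ring
  set T₀ : (W.map (algebraMap ℚ (AlgebraicClosure ℚ))).toAffine.Point := φ.symm (Affine.Point.some 0 0 h0ns) with hT₀
  have hT₀2 : (2 : ℤ) • T₀ = 0 := by rw [hT₀, ← map_zsmul, h02, map_zero]
  have hT₀eq : T₀ = φ.symm (Affine.Point.some 0 0 h0ns) := rfl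
  rw [hφ, VariableChange.pointEquiv_symm_apply, VariableChange.pointInv_some] at hT₀eq
  have hvξ0 : v ξ'' ≠ 0 := by
    intro h0; rw [h0, zero_pow (by norm_num), zero_mul] at hξ''; exact zero_ne_one hξ''
  have hξ0 : ξ'' ≠ 0 := (Valuation.ne_zero_iff _).mp hvξ0
  have hxξ : x'' - ξ'' ≠ 0 := by
    intro h0
    have hx0 : x'' = ξ'' := sub_eq_zero.mp h0
    rw [hx0] at hx''
    have e9 : v ξ'' ^ 162 * t ^ (9 * m) = 1 := by
      rw [show (162 : ℕ) = 18 * 9 from rfl, pow_mul, show (9 * m : ℕ) = m * 9 from Nat.mul_comm _ _,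
        pow_mul, ← mul_pow, hξ'', one_pow]
    have e8 : t ^ (8 * m) = 1 := by
      have h9m : t ^ (9 * m) = t ^ m * t ^ (8 * m) := by rw [← pow_add]; congr 1; ring
      rw [h9m, ← mul_assoc, hx'', one_mul] at e9
      exact e9
    have : t ^ (8 * m) < 1 := pow_lt_one₀ zero_le ht1 (by omega)
    exact absurd e8 this.ne
  have hu0 : (C.u : (AlgebraicClosure ℚ)) ≠ 0 := C.u.ne_zero
  -- the coefficients of `W ⊗ ℚ̄` in terms of the shape: `b₂ = 4u²A − 12r`, …
  have hb2 := variableChange_b₂ (W.map (algebraMap ℚ (AlgebraicClosure ℚ))) C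
  have hb4 := variableChange_b₄ (W.map (algebraMap ℚ (AlgebraicClosure ℚ))) C
  have hb6 := variableChange_b₆ (W.map (algebraMap ℚ (AlgebraicClosure ℚ))) C
  rw [← hE''] at hb2 hb4 hb6
  rw [b₂_of_shape h1] at hb2
  rw [b₄_of_shape h1 h3 h4] at hb4
  rw [b₆_of_shape h3 h6] at hb6
  rw [map_b₂] at hb2 hb4 hb6
  rw [map_b₄] at hb4 hb6
  rw [map_b₆] at hb6
  have huinv : ((C.u⁻¹ : (AlgebraicClosure ℚ)ˣ) : (AlgebraicClosure ℚ)) = (C.u : (AlgebraicClosure ℚ))⁻¹ := Units.val_inv_eq_inv_val _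
  rw [huinv] at hb2 hb4 hb6
  have hB2 : algebraMap ℚ (AlgebraicClosure ℚ) W.b₂ = (C.u : (AlgebraicClosure ℚ)) ^ 2 * (4 * E''.a₂) - 12 * C.r := by
    field_simp at hb2; linear_combination -hb2
  have hB4 : algebraMap ℚ (AlgebraicClosure ℚ) W.b₄ = 2 * (C.u : (AlgebraicClosure ℚ)) ^ 4 - C.r * algebraMap ℚ (AlgebraicClosure ℚ) W.b₂ - 6 * C.r ^ 2 := by
    field_simp at hb4; linear_combination -hb4
  have hB6 : algebraMap ℚ (AlgebraicClosure ℚ) W.b₆ =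
      -(2 * C.r * algebraMap ℚ (AlgebraicClosure ℚ) W.b₄ + C.r ^ 2 * algebraMap ℚ (AlgebraicClosure ℚ) W.b₂ + 4 * C.r ^ 3) := by
    field_simp at hb6; linear_combination -hb6
  have hZ'' := valuation_velu_sub_pow_162_of_shape E''.a₂ hm1 hm4 hα hξ'' hx''
  refine ⟨Q₀, C.ofX x'', C.ofY x'' y'', C.ofX ξ'', C.ofY ξ'' η'', C.ofX 0, C.ofY 0 0, _,
    (VariableChange.nonsingular_ofXY_iff (W.map (algebraMap ℚ (AlgebraicClosure ℚ))) C ξ'' η'').mpr hPns,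
    (VariableChange.nonsingular_ofXY_iff (W.map (algebraMap ℚ (AlgebraicClosure ℚ))) C 0 0).mpr h0ns,
    hQ₀eq, hQ₀9, ?_, ?_, ?_, ?_, ?_⟩
  · rw [← hP₀eq]; exact hQ₀3
  · rw [← hT₀eq]; exact hT₀2
  · rw [VariableChange.ofX_def, VariableChange.ofX_def,
      show (C.u : (AlgebraicClosure ℚ)) ^ 2 * x'' + C.r - ((C.u : (AlgebraicClosure ℚ)) ^ 2 * ξ'' + C.r) = (C.u : (AlgebraicClosure ℚ)) ^ 2 * (x'' - ξ'') by ring]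
    exact mul_ne_zero (pow_ne_zero _ hu0) hxξ
  · rw [VariableChange.ofX_def, VariableChange.ofX_def,
      show (C.u : (AlgebraicClosure ℚ)) ^ 2 * 0 + C.r - ((C.u : (AlgebraicClosure ℚ)) ^ 2 * ξ'' + C.r) = -((C.u : (AlgebraicClosure ℚ)) ^ 2 * ξ'') by ring]
    exact neg_ne_zero.mpr (mul_ne_zero (pow_ne_zero _ hu0) hξ0)
  · -- the transport `X(x₀) − X(e) = u² (X''(x'') − X''(0))`
    have h0ξ : (0 : (AlgebraicClosure ℚ)) - ξ'' ≠ 0 := by rwa [zero_sub, neg_ne_zero]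
    have htr :
        (C.ofX x'' + (6 * C.ofX ξ'' ^ 2 + algebraMap ℚ (AlgebraicClosure ℚ) W.b₂ * C.ofX ξ'' + algebraMap ℚ (AlgebraicClosure ℚ) W.b₄) /
              (C.ofX x'' - C.ofX ξ'') +
            (4 * C.ofX ξ'' ^ 3 + algebraMap ℚ (AlgebraicClosure ℚ) W.b₂ * C.ofX ξ'' ^ 2 +
                2 * algebraMap ℚ (AlgebraicClosure ℚ) W.b₄ * C.ofX ξ'' + algebraMap ℚ (AlgebraicClosure ℚ) W.b₆) /
              (C.ofX x'' - C.ofX ξ'') ^ 2) -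
          (C.ofX 0 + (6 * C.ofX ξ'' ^ 2 + algebraMap ℚ (AlgebraicClosure ℚ) W.b₂ * C.ofX ξ'' + algebraMap ℚ (AlgebraicClosure ℚ) W.b₄) /
              (C.ofX 0 - C.ofX ξ'') +
            (4 * C.ofX ξ'' ^ 3 + algebraMap ℚ (AlgebraicClosure ℚ) W.b₂ * C.ofX ξ'' ^ 2 +
                2 * algebraMap ℚ (AlgebraicClosure ℚ) W.b₄ * C.ofX ξ'' + algebraMap ℚ (AlgebraicClosure ℚ) W.b₆) /
              (C.ofX 0 - C.ofX ξ'') ^ 2) =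
        (C.u : (AlgebraicClosure ℚ)) ^ 2 *
          ((x'' + (6 * ξ'' ^ 2 + 4 * E''.a₂ * ξ'' + 2) / (x'' - ξ'') +
              (4 * ξ'' ^ 3 + 4 * E''.a₂ * ξ'' ^ 2 + 4 * ξ'') / (x'' - ξ'') ^ 2) -
            (0 + (6 * ξ'' ^ 2 + 4 * E''.a₂ * ξ'' + 2) / (0 - ξ'') +
              (4 * ξ'' ^ 3 + 4 * E''.a₂ * ξ'' ^ 2 + 4 * ξ'') / (0 - ξ'') ^ 2)) := by
      have hd1 : C.ofX x'' - C.ofX ξ'' = (C.u : (AlgebraicClosure ℚ)) ^ 2 * (x'' - ξ'') := by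
        rw [VariableChange.ofX_def, VariableChange.ofX_def]; ring
      have hd2 : C.ofX 0 - C.ofX ξ'' = (C.u : (AlgebraicClosure ℚ)) ^ 2 * (0 - ξ'') := by
        rw [VariableChange.ofX_def, VariableChange.ofX_def]; ring
      rw [hd1, hd2, hB6, hB4, hB2]
      simp only [VariableChange.ofX_def]
      field_simp
      ring
    rw [htr, map_mul, mul_pow, hZ'', map_pow, ← pow_mul]
    -- `v(u)¹² = v(Δ_W)` read in `ℚ̄`
    have huΔ : v (C.u : (AlgebraicClosure ℚ)) ^ 12 = v (algebraMap ℚ (AlgebraicClosure ℚ) W.Δ) := by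
      have e1 : E''.Δ = (C.u⁻¹ : (AlgebraicClosure ℚ)ˣ) ^ 12 * algebraMap ℚ (AlgebraicClosure ℚ) W.Δ := by
        rw [hE'', variableChange_Δ, map_Δ]
      have := congrArg v e1
      rw [hΔ1, map_mul, map_pow, Units.val_inv_eq_inv_val, map_inv₀] at this
      have hvu0 : v (C.u : (AlgebraicClosure ℚ)) ≠ 0 := (Valuation.ne_zero_iff _).mpr hu0
      rw [inv_pow, eq_comm, inv_mul_eq_one₀ (pow_ne_zero _ hvu0)] at this
      exact this
    rw [show 2 * 162 = 12 * 27 from rfl, pow_mul, huΔ]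

end Main

end Summit.BirchSwinnertonDyer.Rank1Residual.GaloisImage

end
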